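/-
Copyright: publication-cell `pub-balaban` (b2b), seat b2b-balaban-b10 gen 24 (v1).  Literature leaf — one-variable
complex analysis (Mathlib's identity theorem for analytic functions on a preconnected open set), the real/imaginary-part
decomposition and the exponential of a unital C⋆-algebra, convexity, and one-line applications of the lineage's joint
theorems only; every theorem is kernel-proved and tagged [folklore] or [cite: …] (a LOCATED printed shape); the objects
are MODEL OBJECTS (the sibling interfaces `Tube`, `TubeCfg`, `TubeIdentity`, `measE`, `commSpan`, `expLine`), never
asserted to be Bałaban's; NO new cited facts, NO summit vocabulary.
-/
import Mathlib
import Literature.MathematicalPhysics.QuantumFieldTheory.Balaban1983to89.B10Eq26MeasureInv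

/-!
# `Balaban1983to89.B10Eq26TubeIdentity` — [Balaban1985UV3] (26) p. 263 with *"The third property is the analyticity
# with respect to U₁"*, and [Balaban1987RG1] p. 283 *"implied by the invariance with respect to G-valued
# transformations, and by the analyticity of the function"*: THE IDENTITY PRINCIPLE ALONG THE UNITARY SLICE IS A
# THEOREM — the hypothesis shape (H6) `TubeIdentity ι 𝔸 a` of `B10Eq26MeasureInv` HOLDS for every unital C⋆-algebra
# `𝔸`, every finite bond set `ι` and every half-width `a` (two functions holomorphic on the bondwise tube
# `TubeCfg ι 𝔸 a` which agree on the unitary-valued configurations agree on the tube), so the lineage's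
# class-function binder `hcls` on the COMPLEX tube is DISCHARGED from (26) for the constant gauge transformations on
# the `G`-valued configurations + holomorphy on the tube, with no further hypothesis

T. Bałaban, *Ultraviolet stability of three-dimensional lattice pure gauge field theories*, Commun. Math. Phys.
**102**, 255–275 (1985) [Balaban1985UV3] (cell paper B10; PDF `paper:balaban1985-cmp102-uv-stability-3d`, journal page
= PDF page + 254); T. Bałaban, *Renormalization group approach to lattice gauge field theories. I*, Commun. Math.
Phys. **109**, 249–301 (1987) [Balaban1987RG1] = [I]; *… II*, Commun. Math. Phys. **116**, 1–22 (1988)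
[Balaban1988RG2Cluster] = [II]. Every quotation in this header is RE-KEYED byte-for-byte (whitespace re-flowed) from
the §0 of the tree modules `…B10Eq26MeasureInv` (b10 gen 23; B10 pp. 262–263, read there as images from the renders
`b2b-balaban-ref1/pages/1985-cmp102-uv-stability-3d/…-p008-x4.png`, `…-p009-x4.png`) and `…B10Eq31GlobalConj` (b10 gen
21; B10 p. 264, [I] pp. 262, 263, 283, [II] pp. 21–22, renders named there); nothing new is quoted and this module
adds NO cited fact. Sibling imported BY NAME (byte-identical, nothing edited): `…B10Eq26MeasureInv` (hence
`…B10Eq32SuN`, `…B10Eq31GlobalConj`, `…B10Eq29TubeLine`, `…B10Eq61PerSite`, `…B10Eq61Leaves`: `Tube`, `TubeCfg`,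
`TubeIdentity`, `measE`, `classFn_of_unitaryClassFn`, `classFn_measE_of_unitaryCov`, `differentiable_conj`,
`conj_mem_tubeCfg`, `commSpan`, `I_smul_mem_skewAdjoint`, `flowInvariant_of_classFn`, `diffAlongV`, `expLine`,
`cstarAlgebraMatrix`, `logHalfBound_expLine_cplx_of_classFn`, `bound118_secondOrder_expLine_cplx_of_classFn`,
`logHalfBound_expLine_of_classFn`, `classFn_of_suClassFn`, `mem_closure_commSpan_of_trace_eq_zero`).

WHY THIS MODULE (the b10 lineage's open edge after `B10Eq26MeasureInv` v1: its (J-b) join `classFn_of_unitaryClassFn`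
turns (26) on the `G`-valued configurations + holomorphy on the tube into the lineage's binder `hcls` ONLY UNDER the
named [folklore] hypothesis shape (H6) `TubeIdentity` — «an IDENTITY PRINCIPLE along the unitary slice … not proved
here»; adv2 XREAD C-adv2-75 SUGGESTION «prove `TubeIdentity` for `M_N(ℂ)`»; cell GAPS C-B13-32 / C-adv2-63 R1 /
C-b10g19-2 (iii) «a located `hcls` for the printed pieces»). Every joint theorem of the lineage (`B10Eq61Leaves` …
`B10Eq26MeasureInv`) carries `hcls : ∀ X, ∀ W ∈ unitary 𝔸, ∀ V ∈ TubeCfg ι 𝔸 a, E X (W·V·W⋆) = E X V` — (26) for the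
constant gauge transformations READ ON THE COMPLEX TUBE, whereas print states (26) for `G`-valued configurations and
separately that the expressions are analytic in `U₁` and *"extended analytically"*. This module PROVES the
continuation step in the lineage's model, for every unital C⋆-algebra at once (so for `ℂ`, `M_N(ℂ)`, `B(H)`): (H6) is
a theorem (`tubeIdentity`, §2), hence `hcls` follows from the two located printed properties alone (§3) and every
joint theorem can be restated with (26) asked only where print states it (§4–§5).

WHAT IS PRINTED (verbatim, re-keyed as said above; nothing new).
* B10 pp. 262–263 (the three properties and the mechanism of (26)): *"Besides the bounds (25) the expressions 𝒫′₁ have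
  three very important properties. The first is gauge invariance with respect to all gauge transformations of the
  configuration U₁, i.e. the following"* [p. 263] *"equalities hold 𝒫′₁(g₀, X, U₁ᵘ) = 𝒫′₁(g₀, X, U₁), (26) for all
  gauge transformations 𝓊. The second is a localization property with respect to U₁. The expression 𝒫′₁(g₀, X, U₁)
  depends on U₁ restricted to the set X̃⁵ (let us recall that X̃⁵ = ∪_{□⊂X} □̃⁵). The third property is the
  analyticity with respect to U₁. These properties follow from the results of previous papers; let us make a comment
  only on the gauge invariance (26). It follows from the invariance of the expressions in (13), if we make the
  simultaneous transformations U₁ → U₁ᵘ, A′ → R(𝓊)A′, we have to notice only that all the expansions and expressions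
  introduced later preserve this property. The measure dA is invariant with respect to the orthogonal transformations
  A → R(𝓊)A, hence the desired invariance (26) follows."*
* B10 p. 264 (after (31)): *"We have to notice only that (26) holds for all regular gauge field configurations, not
  only for the minimal configurations U₁."*
* [I] p. 262, (1.11)–(1.13) (the complex configuration space the tube models): *"(i) 𝐔 = U′U, U has values in the
  group G, |∂U − 1| < α₀ξ² on X, (1.11) for each cube □ ⊂ X of a size O(1)LM there exists a G-valued gauge
  transformation u defined on □ and such, that Uᵘ = exp iξA, |A|, |∇^ξA| < O(1)LMBα₀ on □, (1.12) with a sufficiently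
  large constant B (it will be determined later). (ii) U′ = exp iξA′, A′ has values in the algebra gᶜ, |A′|, |∇^ξ_U
  A′| < α₁ on X. (1.13)"*
* [I] p. 263, (1.19): *"The most important is gauge invariance. We assume that all functions 𝐄⁽ʲ⁾(X, g_{j−1}, 𝐔, 𝐉)
  are gauge invariant with respect to the group of all gauge transformations (1.10). Explicitly 𝐄⁽ʲ⁾(X, g_{j−1}, 𝐔ᵘ,
  R(u)𝐉) = 𝐄⁽ʲ⁾(X, g_{j−1}, 𝐔, 𝐉) (1.19) for all Gᶜ-valued gauge transformations u. The spaces Uᶜ_j(X, α₀, α₁) are, by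
  the definition, gauge invariant also."*
* [I] p. 283: *"We assume the gauge invariance with respect to Gᶜ-valued gauge transformations, but it is implied by
  the invariance with respect to G-valued transformations, and by the analyticity of the function, as it was noticed
  already."*
* [II] p. 21, last paragraph (running on to p. 22): *"the expressions (2.14) are gauge invariant with respect to all
  G-valued transformations. The expressions are analytic functions of (U,J), hence the invariance can be extended, by
  the analyticity, to Gᶜ-valued gauge transformations in a small neighborhood of the space of G-valued ones."* — and:
  *"This means that the expressions are constant on intersections of orbits with the corresponding space of
  configurations (𝐔, 𝐉) satisfying the conditions I.(i)–(iv). We extend them to constant functions on whole orbits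
  having non-empty intersections with the space. The above remark completes the proof of the inductive assumptions for
  the action A_{k+1}, hence the proof of Theorem I.3."*

THE PROOF (the one mathematical idea; [folklore] — the function-theoretic form of the uniqueness half of Weyl's
unitarian trick, `𝔤𝔩 = 𝔲 ⊕ i𝔲`, e.g. W. Rossmann, *Lie groups: an introduction through linear groups*, OUP 2002, §6.5
Theorem 3; no several-complex-variables input — Hartogs, totally real submanifolds — is used). A tube point is `V =
(exp(B_b)·U_b)_b` with `‖B_b‖ < a` and `U_b` unitary. Write `B_b = ℜB_b + i·ℑB_b` with `ℜ`, `ℑ` the self-adjoint real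
and imaginary parts and consider the ONE-PARAMETER holomorphic curve `c(t) = (exp(i(ℑB_b − t·ℜB_b))·U_b)_b`, `t ∈ ℂ`
(`sliceCurve`): at `t = i` it passes through `V`; for REAL `t` every exponent is skew-adjoint, so `c(t)` is
unitary-valued; and `c(t)` lies in the tube whenever `t` is in the SLICE REGION `Ω = {t | ∀ b, ‖ℑB_b − t·ℜB_b‖ < a}`
(`sliceRegion`), which is OPEN (finitely many bonds), CONVEX (each condition is the preimage of a ball under a
real-linear map), contains `0` (`‖ℑB_b‖ ≤ ‖B_b‖ < a`, a C⋆-fact) and contains `i` (`ℑB_b − i·ℜB_b = −i·B_b`). Hence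
for `φ`, `ψ` holomorphic on the tube and equal on unitary-valued configurations, `φ ∘ c` and `ψ ∘ c` are analytic on
the preconnected open set `Ω ∋ 0` and agree at its real points, which are frequent in the punctured neighbourhood of
`0`; by Mathlib's one-variable identity theorem `AnalyticOnNhd.eqOn_of_preconnected_of_frequently_eq` they agree on
`Ω`, in particular at `t = i`: `φ V = ψ V`.

WHAT IS KERNEL-CERTIFIED ([folklore] mathematics throughout; the value is that (H6) leaves the hypothesis list of the
lineage).
(§1) THE SLICE LINE `sliceGen B t = i·(ℑB − t·ℜB)`: complex-differentiable in `t` (`differentiable_sliceGen`), `= B`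
  at `t = i` (`sliceGen_I`), skew-adjoint at real `t` (`sliceGen_ofReal_mem_skewAdjoint`) so that `exp(sliceGen B
  t)·U` is unitary for unitary `U` (`exp_sliceGen_ofReal_mul_mem_unitary`, Mathlib's
  `NormedSpace.exp_mem_unitary_of_mem_skewAdjoint`), `‖sliceGen B 0‖ ≤ ‖B‖` (`norm_sliceGen_zero_le`, Mathlib's
  `imaginaryPart.norm_le`), with open convex strict sublevel sets `{t | ‖sliceGen B t‖ < a}` (`isOpen_…`,
  `convex_setOf_norm_sliceGen_lt`, via `convex_setOf_norm_sub_smul_lt`: a preimage of a ball under `t ↦ t·Q`); the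
  SLICE CURVE `sliceCurve B U` is holomorphic (`differentiable_sliceCurve`, Mathlib's `NormedSpace.exp_analytic`),
  passes through `(exp(B b)·U b)_b` at `t = i` (`sliceCurve_I`), is unitary-valued at real `t`
  (`sliceCurve_ofReal_mem_unitary`) and maps the SLICE REGION `sliceRegion B a` — convex, open, `∋ 0, i` when `‖B b‖ <
  a` for all `b` (`convex_sliceRegion`, `isOpen_sliceRegion`, `zero_mem_sliceRegion`, `I_mem_sliceRegion`) — into the
  tube (`mapsTo_sliceCurve`); real points are frequent along `𝓝[≠] (0 : ℂ)`
  (`frequently_nhdsNE_zero_of_forall_ofReal`).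
(§2) THE THEOREM `tubeIdentity (a : ℝ) : TubeIdentity ι 𝔸 a` (`[Fintype ι]`, `[CStarAlgebra 𝔸]`, every `a`), its
  unfolded form `eqOn_tubeCfg_of_eqOn_unitary`, and — print's sentence in the TRANSFORMATION variable, [I] p. 283 /
  [II] p. 21, in the model — `eq_const_on_tubeCfg_of_unitary`: a function holomorphic on the tube and constant on the
  unitary-valued points is that constant on the tube.
(§3) (J-b) OF `B10Eq26MeasureInv` MADE UNCONDITIONAL: (26) for the constant gauge transformations on the
  UNITARY-valued configurations + holomorphy of each `E X` on the tube give the lineage's binder `hcls` on the tube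
  (`classFn_tube_of_unitary`; `conjInvariant_tube_of_unitary` for one function), hence the flow invariance `E X (Ad
  e^{tl} V) = E X V` on the tube consumed by the (31) ⇒ (32) derivations (`flowInvariant_tube_of_unitary`); measure
  form: covariance of the fluctuation measure `ν` and joint invariance of the integrand `F` ON THE UNITARY-VALUED
  CONFIGURATIONS (the hypotheses (H3)/(H2) of `B10Eq26MeasureInv`, now asked where print states the mechanism) +
  holomorphy of `measE ν F X` on the tube give `hcls` (`classFn_measE_tube_of_unitaryCov`).
(§4) THE JOINT THEOREMS WITH `hcls` REPLACED BY (26) ON UNITARY-VALUED CONFIGURATIONS (`h26`), every other binder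
  verbatim (holomorphy on the tube is already `hE` + `hsp`), same constants and rates:
  `logHalfBound_expLine_cplx_of_unitaryClassFn` (complex (61)-pieces, the (24)-type bound; constant `8·((2p +
  q)/(min(1/8, a/2) − p))²·B`, rate `r − 2`), `bound118_secondOrder_expLine_cplx_of_unitaryClassFn` ((I.1.18)-type,
  [II]'s letters with printed R21; `(64A(1 + c₀²)/(min(1/8, a/2) − α₁)²)·c₁`, `r − 3`),
  `logHalfBound_expLine_of_unitaryClassFn` (real backgrounds; `8((p + q)/a)²·B`, `r − 2`),
  `logHalfBound_expLine_cplx_of_unitaryCov` (measure-defined family: the two measure-level hypotheses on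
  unitary-valued configurations only).
(§5) THE `SU(N)` FORMS over `M_N(ℂ)` (`cstarAlgebraMatrix N` threaded by `letI`, no global instance): (26) for the
  CONSTANT gauge transformations with values in `SU(N)` on the `U(N)`-valued configurations + holomorphy on the tube
  give the `U(N)`-class-function binder on the tube (`classFn_tube_of_suUnitary`: `classFn_of_suClassFn`, i.e. `U(N) =
  U(1)·SU(N)` with the centre invisible, applied on the unitary slice BEFORE the continuation), whence with traceless
  generators (`mem_closure_commSpan_of_trace_eq_zero`) the three bounds
  `logHalfBound_expLine_cplx_of_suUnitaryClassFn`, `bound118_secondOrder_expLine_cplx_of_suUnitaryClassFn`,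
  `logHalfBound_expLine_of_suUnitaryClassFn`; `tubeIdentity_matrix` records (H6) for `M_N(ℂ)` (adv2 C-adv2-75
  SUGGESTION, here a special case).
(§6) NON-VACUITY / SHARPNESS: (T1) the tube is strictly bigger than the unitary slice already for `𝔸 = ℂ`, one bond,
  `a = 1` — `e^{1/2}` is in the tube and not unitary (`example_tube_not_unitary`), so `tubeIdentity` has content; (T2)
  the slice must be the WHOLE unitary group of the bond algebra: on `M₃(ℂ)` the polynomial `det(V b₀)` and `1` agree
  on `SU(3)`-valued configurations and differ at the unitary `−1` (`example_su_slice_too_small`), so (26) on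
  `SU(N)`-valued configurations alone does not determine a function on the `M_N(ℂ)`-tube (HONEST SCOPE (iii)); (T3)
  joint satisfiability of the binders of the `SU(N)` forms is already witnessed in the tree: the `M₂(ℂ)`, `SU(2)`,
  R21-true data of `B10Eq32SuN.example_bound118_expLine_cplx_m2_R21` satisfy every binder of
  `bound118_secondOrder_expLine_cplx_of_suUnitaryClassFn` (its `SU(2)`-class-function binder on the tube, there
  `m2E_suClassFn` for all configurations, implies `h26`), with differenced family `−4 ≠ 0`
  (`B10Eq32SuN.example_diffAlongV_m2_R21`); re-deriving the identical conclusion here would restate a landed theorem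
  (gate `dedup.landed`), so it is cited by name, not repeated.

HYPOTHESIS SHAPES (located, never asserted; binders of the theorems, in print's words). (h26) `∀ W ∈ unitary 𝔸, ∀ V,
(∀ b, V b ∈ unitary 𝔸) → E X (W·V_b·W⋆)_b = E X V` — *"equalities hold 𝒫′₁(g₀, X, U₁ᵘ) = 𝒫′₁(g₀, X, U₁), (26) for all
gauge transformations 𝓊"* (B10 p. 263) for the CONSTANT `𝓊 ≡ W` and `G`-valued `U₁`, with `G` = the unitary group of
the bond algebra (HONEST SCOPE (iii)). (hE)/(hEan) `DifferentiableOn ℂ (E X) (TubeCfg ι 𝔸 a)` (or on `sp X ⊇` tube) —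
*"The third property is the analyticity with respect to U₁"* (B10 p. 263), on the complex space *"U′ = exp iξA′, A′
has values in the algebra gᶜ, |A′| … < α₁"* ([I] (1.13)). (hν)/(hF) on unitary-valued configurations — the
measure-level mechanism of (26) (B10 p. 263, the hypotheses (H3)/(H2) of `B10Eq26MeasureInv`). (htr) traceless
generators — (27) and *"𝔤 is semi-simple"* (B10 p. 264) for `G = SU(N)`, as in `B10Eq32SuN`.

HONEST SCOPE. (i) A MODEL: the tube `TubeCfg ι 𝔸 a` (`V b = exp(B)·U`, `‖B‖ < a`, `U` unitary, bond by bond, one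
unital C⋆-algebra per bond) is the lineage's model of the complex configuration space (1.11)–(1.13) `𝐔 = U′U`;
`tubeIdentity` is a theorem about THIS set; nothing of Bałaban's `𝒫′₁`, `Uᶜ_j(X, α₀, α₁)`, `𝐄⁽ʲ⁾` is constructed, and
(h26), (hE) remain HYPOTHESES about print's expressions (located: the first and third properties of p. 263). (ii)
WHICH VARIABLE: print's continuation sentence ([I] p. 283, [II] p. 21) is in the TRANSFORMATION variable `u`
(`G`-valued → `Gᶜ`-valued near `G`, the configuration fixed), whereas the lineage's `hcls` needs the continuation in
the CONFIGURATION variable (from `G`-valued `U₁` to the complex tube, `W` unitary and fixed) — B10's *"analyticity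
with respect to U₁"* is the analyticity consumed; both are instances of the same abstract theorem, and §2's
`eq_const_on_tubeCfg_of_unitary` is the transformation-variable form (with `ι` = sites) PROVIDED `u ↦ E(𝐔ᵘ)` is
holomorphic on the site-wise tube — site-dependent transformations and that holomorphy are NOT modelled by the lineage
(`B10Eq31GlobalConj` HONEST SCOPE (ii): constant transformations only). (iii) THE SLICE IS `U(𝔸)^ι`, the full unitary
group of the bond algebra: for `𝔸 = M_N(ℂ)` this is `U(N)^ι`, i.e. the `G = U(N)` reading of the configuration space.
For print's semisimple `G = SU(N) ⊂ U(N)` the printed (26) concerns `SU(N)`-valued configurations and the `𝔰𝔩_N`-tube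
`exp(i·𝔰𝔩_N)·SU(N)` around them, and agreement on `SU(N)^ι` does NOT determine a holomorphic function on the
`M_N(ℂ)`-tube ((T2): `det` versus `1`); so §5 asks (26) on the `U(N)`-valued configurations (for `SU(N)`-valued
constant transformations), which for `G = SU(N)` is a statement about the lineage's `U(N)`-model — the same model and
tube as `B10Eq32SuN` — not a printed one. The `G`-sub-tube version of `tubeIdentity` (the same slice curve works: `ℜ`,
`ℑ` of a traceless `B` are traceless and `exp` of a traceless skew-Hermitian matrix lies in `SU(N)`) is NOT typed
here, because no joint theorem of the lineage is posed on a sub-tube. (iv) FINITELY MANY BONDS (`[Fintype ι]`, as in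
every joint theorem of the lineage); `a` arbitrary (for `a ≤ 0` the tube is empty and everything is vacuous). (v) No
bound is improved and no constant changes: §4–§5 are the lineage's theorems with one binder discharged; no (23)–(25),
no convergence, no continuum statement. (vi) Not summit progress, not Clay progress; cell GAPS C-B13-32 moves, for the
(J-b) reading, from «(26) on `G`-valued configurations + analyticity + a named identity-principle hypothesis (H6)» to
«(26) on unitary-valued configurations for the constant transformations + analyticity on the tube», both located
printed properties and both still hypotheses about print's never-constructed `𝒫′₁` — no further. (vii) OWED, NOT DONE
HERE (cell rule: no DOCFIX-only revisions): pv10 XREAD C-pv10-88 DOCFIX D1 (the B10 p. 262 «X_m ∩ □ⱼ ≠ ∅» [sic] note)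
and adv2 XREAD C-adv2-75 DOCFIX-1 (HONEST SCOPE (ii) wording of `B10Eq26MeasureInv`: `ν V` is a real measure, the
continued density lives in `F`) stay owed to that module's next substantive revision; this leaf imports it unchanged.

SIBLING PRIOR ART (disclosed by name, not imported; cell GAPS C-b10g23-2 practice).
`frequently_nhdsNE_zero_of_forall_ofReal` has the same statement as
`Literature.Analysis.Complex.SeparatelyHolomorphicStrips.frequently_nhdsNE_zero_of_forall_ofReal` and as
`Literature.Analysis.Complex.LaguerrePolya.tendsto_ofReal_nhdsNE_zero` + `Filter.Tendsto.frequently` (used there and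
in `…HalfLinePositiveDefiniteHolomorphic.frequently_nhdsNE_ofReal` for one-variable strip / half-line identity
theorems such as `eqOn_setOf_abs_im_lt_of_forall_ofReal`); those modules' import closures (Fourier decay,
Phragmén–Lindelöf, Vitali, parametric integrals) are foreign to this cell, so the ten-line [folklore] lemma is
re-proved here with its own proof (the real point `ε/2` of a punctured ball). No identity principle for holomorphic
functions on a tube around the unitaries of an operator algebra exists elsewhere in the tree (`lean search` for
`TubeIdentity`, `totally real`, `unitarian`, 2026-08-19: no hit outside this lineage); the nearest relative is the
POLYNOMIAL statement «a complex polynomial vanishing on the totally real subspace of block-Hermitian matrices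
vanishes» inside `Literature.Algebra.Lie.ChevalleyRestrictionGL.eq_zero_of_coadDer_eq_zero_of_restrictDiag_eq_zero`
(grid argument, a different mechanism, not usable for holomorphic functions).

RECORDS: cell GAPS C-b10g24-1 (this module), C-B13-32 UPDATE (b10-g24); DIVERGENCE D-b10.29; no new bib key (keys
used: Balaban1985UV3, Balaban1987RG1, Balaban1988RG2Cluster, all in references.bib).
-/

open Metric Set Filter MeasureTheory NormedSpace
open scoped Topology ComplexStarModule

namespace Literature.MathematicalPhysics.QuantumFieldTheory.Balaban1983to89.B10Eq26TubeIdentity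

open B10Eq61PerSite (diffAlongV)
open B10Eq29TubeLine (Tube TubeCfg expLine cstarAlgebraMatrix mem_tube mem_tubeCfg exp_mul_mem_tube)
open B10Eq31GlobalConj (conj_mem_tubeCfg commSpan I_smul_mem_skewAdjoint flowInvariant_of_classFn
  logHalfBound_expLine_cplx_of_classFn bound118_secondOrder_expLine_cplx_of_classFn logHalfBound_expLine_of_classFn)
open B10Eq32SuN (classFn_of_suClassFn mem_closure_commSpan_of_trace_eq_zero)
open B10Eq26MeasureInv (TubeIdentity measE differentiable_conj classFn_of_unitaryClassFn classFn_measE_of_unitaryCov)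

/-! ## §1. [folklore] The slice line, the slice curve and the slice region -/

section Slice

variable {ι : Type*} {𝔸 : Type*} [CStarAlgebra 𝔸]

/-- THE SLICE LINE through `B`: `sliceGen B t = i·(ℑB − t·ℜB)`, where `ℜB = ½(B + B⋆)` and `ℑB = −(i/2)(B − B⋆)` are
Mathlib's self-adjoint real and imaginary parts (`realPart`, `imaginaryPart`).  Complex-affine in `t`; equal to `B`
at `t = i`; skew-adjoint at real `t`; of norm `‖ℑB‖ ≤ ‖B‖` at `t = 0`. [folklore] -/
noncomputable def sliceGen (B : 𝔸) (t : ℂ) : 𝔸 := Complex.I • ((ℑ B : 𝔸) - t • (ℜ B : 𝔸))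

/-- `sliceGen B i = B` (`ℜB + i·ℑB = B`, Mathlib's `realPart_add_I_smul_imaginaryPart`). [folklore] -/
theorem sliceGen_I (B : 𝔸) : sliceGen B Complex.I = B := by
  rw [sliceGen, smul_sub, smul_smul, Complex.I_mul_I, neg_one_smul, sub_neg_eq_add, add_comm]
  exact realPart_add_I_smul_imaginaryPart B

/-- `sliceGen B 0 = i·ℑB`. [folklore] -/
theorem sliceGen_zero (B : 𝔸) : sliceGen B 0 = Complex.I • (ℑ B : 𝔸) := by
  rw [sliceGen, zero_smul, sub_zero]

/-- `‖sliceGen B 0‖ = ‖ℑB‖ ≤ ‖B‖` (Mathlib's `imaginaryPart.norm_le`; a C⋆-fact, `‖B⋆‖ = ‖B‖`). [folklore] -/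
theorem norm_sliceGen_zero_le (B : 𝔸) : ‖sliceGen B 0‖ ≤ ‖B‖ := by
  rw [sliceGen_zero, norm_smul, Complex.norm_I, one_mul]
  exact imaginaryPart.norm_le B

/-- At a REAL parameter the slice line is skew-adjoint: `(i(ℑB − tℜB))⋆ = −i(ℑB − tℜB)`. [folklore] -/
theorem sliceGen_ofReal_mem_skewAdjoint (B : 𝔸) (t : ℝ) : sliceGen B (t : ℂ) ∈ skewAdjoint 𝔸 := by
  refine I_smul_mem_skewAdjoint ?_
  rw [star_sub, star_smul, selfAdjoint.star_val_eq, selfAdjoint.star_val_eq, Complex.star_def,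
    Complex.conj_ofReal]

/-- Hence `exp(sliceGen B t)·U` is unitary for real `t` and unitary `U` (Mathlib's
`NormedSpace.exp_mem_unitary_of_mem_skewAdjoint`). [folklore] -/
theorem exp_sliceGen_ofReal_mul_mem_unitary (B : 𝔸) (t : ℝ) {U : 𝔸} (hU : U ∈ unitary 𝔸) :
    exp (sliceGen B (t : ℂ)) * U ∈ unitary 𝔸 := by
  letI : NormedAlgebra ℚ 𝔸 := NormedAlgebra.restrictScalars ℚ ℂ 𝔸
  exact mul_mem (exp_mem_unitary_of_mem_skewAdjoint (sliceGen_ofReal_mem_skewAdjoint B t)) hU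

/-- The slice line is complex-differentiable (affine) in `t` … [folklore] -/
theorem differentiable_sliceGen (B : 𝔸) : Differentiable ℂ (sliceGen B) := by
  show Differentiable ℂ fun t : ℂ => Complex.I • ((ℑ B : 𝔸) - t • (ℜ B : 𝔸))
  fun_prop

/-- … and continuous. [folklore] -/
theorem continuous_sliceGen (B : 𝔸) : Continuous (sliceGen B) :=
  (differentiable_sliceGen B).continuous

/-- The slice line in the form `P − t·Q`: `sliceGen B t = i·ℑB − t·(i·ℜB)`. [folklore] -/
theorem sliceGen_eq_sub_smul (B : 𝔸) (t : ℂ) :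
    sliceGen B t = Complex.I • (ℑ B : 𝔸) - t • (Complex.I • (ℜ B : 𝔸)) := by
  rw [sliceGen, smul_sub, smul_comm]

/-- A strict sublevel set `{t | ‖P − t·Q‖ < a}` of the norm along a complex-affine line is CONVEX: it is the
preimage of the ball `B(P, a)` under the real-linear map `t ↦ t·Q`. [folklore] -/
theorem convex_setOf_norm_sub_smul_lt (P Q : 𝔸) (a : ℝ) : Convex ℝ {t : ℂ | ‖P - t • Q‖ < a} := by
  have h : {t : ℂ | ‖P - t • Q‖ < a} =
      ((LinearMap.toSpanSingleton ℂ 𝔸 Q).restrictScalars ℝ) ⁻¹' Metric.ball P a := by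
    ext t
    simp only [mem_setOf_eq, mem_preimage, Metric.mem_ball', dist_eq_norm, LinearMap.coe_restrictScalars,
      LinearMap.toSpanSingleton_apply]
  rw [h]
  exact (convex_ball P a).linear_preimage _

/-- The strict sublevel sets of `t ↦ ‖sliceGen B t‖` are convex … [folklore] -/
theorem convex_setOf_norm_sliceGen_lt (B : 𝔸) (a : ℝ) : Convex ℝ {t : ℂ | ‖sliceGen B t‖ < a} := by
  simp only [sliceGen_eq_sub_smul]
  exact convex_setOf_norm_sub_smul_lt _ _ a

/-- … and open. [folklore] -/
theorem isOpen_setOf_norm_sliceGen_lt (B : 𝔸) (a : ℝ) : IsOpen {t : ℂ | ‖sliceGen B t‖ < a} :=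
  isOpen_lt (continuous_norm.comp (continuous_sliceGen B)) continuous_const

/-- Real points are frequent in the punctured neighbourhood of `0 ∈ ℂ`: a property of all real parameters holds
frequently along `𝓝[≠] 0` (every punctured ball `B(0, ε) ∖ {0}` contains the real point `ε/2`).  Same statement
as the tree's `Literature.Analysis.Complex.SeparatelyHolomorphicStrips.frequently_nhdsNE_zero_of_forall_ofReal`
(not imported; see the header's SIBLING PRIOR ART). [folklore] -/
theorem frequently_nhdsNE_zero_of_forall_ofReal {p : ℂ → Prop} (hp : ∀ t : ℝ, p t) :
    ∃ᶠ z in 𝓝[≠] (0 : ℂ), p z := by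
  rw [Filter.frequently_iff]
  intro s hs
  obtain ⟨ε, hε, hsub⟩ := Metric.mem_nhdsWithin_iff.1 hs
  refine ⟨((ε / 2 : ℝ) : ℂ), hsub ⟨?_, ?_⟩, hp _⟩
  · rw [Metric.mem_ball, dist_zero_right, Complex.norm_real, Real.norm_eq_abs, abs_of_pos (half_pos hε)]
    exact half_lt_self hε
  · rw [mem_compl_iff, mem_singleton_iff, Complex.ofReal_eq_zero]
    exact (half_pos hε).ne'

/-- THE SLICE CURVE through the tube point `(exp(B b)·U b)_b`: `sliceCurve B U t = (exp(sliceGen (B b) t)·U b)_b`.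
[folklore] -/
noncomputable def sliceCurve (B U : ι → 𝔸) (t : ℂ) : ι → 𝔸 := fun b => exp (sliceGen (B b) t) * U b

/-- At `t = i` the slice curve passes through `(exp(B b)·U b)_b`. [folklore] -/
theorem sliceCurve_I (B U : ι → 𝔸) : sliceCurve B U Complex.I = fun b => exp (B b) * U b :=
  funext fun b => by
    show exp (sliceGen (B b) Complex.I) * U b = exp (B b) * U b
    rw [sliceGen_I]

/-- At REAL `t` the slice curve is unitary-valued (if `U` is). [folklore] -/
theorem sliceCurve_ofReal_mem_unitary (B : ι → 𝔸) {U : ι → 𝔸} (hU : ∀ b, U b ∈ unitary 𝔸) (t : ℝ) (b : ι) :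
    sliceCurve B U (t : ℂ) b ∈ unitary 𝔸 :=
  exp_sliceGen_ofReal_mul_mem_unitary (B b) t (hU b)

/-- THE SLICE REGION: the parameters `t` at which every bond exponent of the slice curve has norm `< a`. [folklore] -/
def sliceRegion (B : ι → 𝔸) (a : ℝ) : Set ℂ := {t | ∀ b, ‖sliceGen (B b) t‖ < a}

/-- Membership in the slice region, unfolded. [folklore] -/
theorem mem_sliceRegion {B : ι → 𝔸} {a : ℝ} {t : ℂ} : t ∈ sliceRegion B a ↔ ∀ b, ‖sliceGen (B b) t‖ < a :=
  Iff.rfl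

/-- The slice region as the intersection of the bondwise sublevel sets. [folklore] -/
theorem sliceRegion_eq_iInter (B : ι → 𝔸) (a : ℝ) :
    sliceRegion B a = ⋂ b, {t : ℂ | ‖sliceGen (B b) t‖ < a} := by
  ext t
  simp only [mem_sliceRegion, mem_iInter, mem_setOf_eq]

/-- The slice region is CONVEX (an intersection of convex sets) … [folklore] -/
theorem convex_sliceRegion (B : ι → 𝔸) (a : ℝ) : Convex ℝ (sliceRegion B a) := by
  rw [sliceRegion_eq_iInter]
  exact convex_iInter fun b => convex_setOf_norm_sliceGen_lt (B b) a

/-- … OPEN when there are finitely many bonds … [folklore] -/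
theorem isOpen_sliceRegion [Finite ι] (B : ι → 𝔸) (a : ℝ) : IsOpen (sliceRegion B a) := by
  rw [sliceRegion_eq_iInter]
  exact isOpen_iInter_of_finite fun b => isOpen_setOf_norm_sliceGen_lt (B b) a

/-- … contains `0` as soon as `‖B b‖ < a` for every bond (`‖ℑ(B b)‖ ≤ ‖B b‖`) … [folklore] -/
theorem zero_mem_sliceRegion {B : ι → 𝔸} {a : ℝ} (hB : ∀ b, ‖B b‖ < a) : (0 : ℂ) ∈ sliceRegion B a :=
  mem_sliceRegion.2 fun b => (norm_sliceGen_zero_le (B b)).trans_lt (hB b)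

/-- … and contains `i` under the same condition (`sliceGen (B b) i = B b`). [folklore] -/
theorem I_mem_sliceRegion {B : ι → 𝔸} {a : ℝ} (hB : ∀ b, ‖B b‖ < a) : Complex.I ∈ sliceRegion B a :=
  mem_sliceRegion.2 fun b => by
    rw [sliceGen_I]
    exact hB b

/-- The slice curve maps the slice region INTO THE TUBE of half-width `a` (if `U` is unitary-valued): bond by bond
`exp(sliceGen (B b) t)·U b` with `‖sliceGen (B b) t‖ < a`. [folklore] -/
theorem mapsTo_sliceCurve (B : ι → 𝔸) {U : ι → 𝔸} (hU : ∀ b, U b ∈ unitary 𝔸) (a : ℝ) :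
    MapsTo (sliceCurve B U) (sliceRegion B a) (TubeCfg ι 𝔸 a) := fun _ ht =>
  mem_tubeCfg.2 fun b => exp_mul_mem_tube (mem_sliceRegion.1 ht b) (hU b)

/-- The slice curve is HOLOMORPHIC (finitely many bonds; `exp` is analytic on a complete normed algebra, Mathlib's
`NormedSpace.exp_analytic`). [folklore] -/
theorem differentiable_sliceCurve [Fintype ι] (B U : ι → 𝔸) : Differentiable ℂ (sliceCurve B U) := by
  have hexp : Differentiable ℂ (exp : 𝔸 → 𝔸) := fun x => (exp_analytic (𝕂 := ℂ) x).differentiableAt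
  exact differentiable_pi.2 fun b => (hexp.comp (differentiable_sliceGen (B b))).mul_const (U b)

end Slice

/-! ## §2. THE IDENTITY PRINCIPLE ALONG THE UNITARY SLICE — the hypothesis shape (H6) `TubeIdentity` of
## `B10Eq26MeasureInv` is a theorem for every unital C⋆-algebra -/

section Identity

variable {ι : Type*} [Fintype ι] {𝔸 : Type*} [CStarAlgebra 𝔸]

/-- **THE IDENTITY PRINCIPLE ALONG THE UNITARY SLICE.**  For every unital C⋆-algebra `𝔸`, every finite bond set
`ι` and every half-width `a`: two functions holomorphic on the bondwise tube `TubeCfg ι 𝔸 a =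
{V | ∀ b, V b = exp(B)·U, ‖B‖ < a, U unitary}` which agree on the unitary-valued configurations agree on the tube
— `B10Eq26MeasureInv.TubeIdentity ι 𝔸 a` HOLDS.  Proof: through a tube point `V = (exp(B b)·U b)_b` run the slice
curve `t ↦ (exp(i(ℑB_b − tℜB_b))·U b)_b` (§1): it is holomorphic, unitary-valued for real `t`, inside the tube on the
open convex slice region `∋ 0, i`, and equals `V` at `t = i`; the two composites are analytic on the slice region and
agree at its real points, which are frequent near `0`, hence agree on it (Mathlib's one-variable identity theorem
`AnalyticOnNhd.eqOn_of_preconnected_of_frequently_eq`), in particular at `t = i`.  This is the located *"extended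
analytically"* / *"implied by the invariance with respect to G-valued transformations, and by the analyticity of the
function"* step ([I] p. 283, [II] p. 21) in the lineage's model, and B10's *"third property … the analyticity with
respect to U₁"* is the analyticity it consumes. [folklore] -/
theorem tubeIdentity (a : ℝ) : TubeIdentity ι 𝔸 a := by
  intro φ ψ hφ hψ hslice V hV
  have hV' : ∀ b, ∃ B U : 𝔸, ‖B‖ < a ∧ U ∈ unitary 𝔸 ∧ V b = exp B * U := fun b =>
    mem_tube.1 (mem_tubeCfg.1 hV b)
  choose B U hB hU hVeq using hV'
  have hf : AnalyticOnNhd ℂ (φ ∘ sliceCurve B U) (sliceRegion B a) :=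
    (hφ.comp (differentiable_sliceCurve B U).differentiableOn (mapsTo_sliceCurve B hU a)).analyticOnNhd
      (isOpen_sliceRegion B a)
  have hg : AnalyticOnNhd ℂ (ψ ∘ sliceCurve B U) (sliceRegion B a) :=
    (hψ.comp (differentiable_sliceCurve B U).differentiableOn (mapsTo_sliceCurve B hU a)).analyticOnNhd
      (isOpen_sliceRegion B a)
  have hreal : ∀ t : ℝ, (φ ∘ sliceCurve B U) (t : ℂ) = (ψ ∘ sliceCurve B U) (t : ℂ) := fun t =>
    hslice _ (sliceCurve_ofReal_mem_unitary B hU t)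
  have hEq : EqOn (φ ∘ sliceCurve B U) (ψ ∘ sliceCurve B U) (sliceRegion B a) :=
    hf.eqOn_of_preconnected_of_frequently_eq hg (convex_sliceRegion B a).isPreconnected
      (zero_mem_sliceRegion hB) (frequently_nhdsNE_zero_of_forall_ofReal hreal)
  have hV₀ : sliceCurve B U Complex.I = V := by
    rw [sliceCurve_I]
    exact funext fun b => (hVeq b).symm
  have h := hEq (I_mem_sliceRegion hB)
  simp only [Function.comp_apply, hV₀] at h
  exact h

/-- The identity principle, unfolded: holomorphic `φ`, `ψ` on the tube agreeing on unitary-valued configurations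
agree on the tube. [folklore] -/
theorem eqOn_tubeCfg_of_eqOn_unitary {a : ℝ} {φ ψ : (ι → 𝔸) → ℂ} (hφ : DifferentiableOn ℂ φ (TubeCfg ι 𝔸 a))
    (hψ : DifferentiableOn ℂ ψ (TubeCfg ι 𝔸 a)) (h : ∀ V : ι → 𝔸, (∀ b, V b ∈ unitary 𝔸) → φ V = ψ V) :
    EqOn φ ψ (TubeCfg ι 𝔸 a) := fun V hV =>
  tubeIdentity a φ ψ hφ hψ h V hV

/-- PRINT'S SENTENCE IN THE TRANSFORMATION VARIABLE, in the model: a function holomorphic on the tube around the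
unitary-valued points (`ι` = sites, `u` = a gauge transformation, the configuration fixed) and CONSTANT (`= c`, the
value at the untransformed configuration) on the unitary-valued `u` — *"gauge invariant with respect to all G-valued
transformations"* — is that constant on the tube — *"hence the invariance can be extended, by the analyticity, to
Gᶜ-valued gauge transformations in a small neighborhood of the space of G-valued ones"* ([II] p. 21), *"implied by
the invariance with respect to G-valued transformations, and by the analyticity of the function"* ([I] p. 283).
The holomorphy of `u ↦ E(𝐔ᵘ)` is the binder `hφ`; site-dependent transformations are not otherwise modelled by the
lineage (header, HONEST SCOPE (ii)). [folklore] -/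
theorem eq_const_on_tubeCfg_of_unitary {a : ℝ} {φ : (ι → 𝔸) → ℂ} (hφ : DifferentiableOn ℂ φ (TubeCfg ι 𝔸 a))
    {c : ℂ} (h : ∀ u : ι → 𝔸, (∀ x, u x ∈ unitary 𝔸) → φ u = c) : ∀ u ∈ TubeCfg ι 𝔸 a, φ u = c :=
  tubeIdentity a φ (fun _ => c) hφ (differentiableOn_const c) h

end Identity

/-! ## §3. (J-b) OF `B10Eq26MeasureInv` MADE UNCONDITIONAL: the class-function binder `hcls` on the complex tube
## from (26) on UNITARY-valued configurations + holomorphy on the tube -/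

section Consequences

variable {ι : Type*} [Fintype ι] {𝔸 : Type*} [CStarAlgebra 𝔸] {a : ℝ}

/-- ONE FUNCTION: `F` holomorphic on the tube and invariant under the bondwise conjugations `V ↦ (W·V_b·W⋆)_b`,
`W` unitary, on the UNITARY-valued configurations — (26) for the constant gauge transformations where print states
it — is invariant under them on the whole tube (the conjugations are holomorphic and preserve the tube,
`B10Eq31GlobalConj.conj_mem_tubeCfg`). [cite: Balaban1985UV3, (26) p.263 + p.263 («third property»); Balaban1987RG1, p.283] -/
theorem conjInvariant_tube_of_unitary {F : (ι → 𝔸) → ℂ} (hF : DifferentiableOn ℂ F (TubeCfg ι 𝔸 a))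
    (h26 : ∀ W ∈ unitary 𝔸, ∀ V : ι → 𝔸, (∀ b, V b ∈ unitary 𝔸) → F (fun b => W * V b * star W) = F V) :
    ∀ W ∈ unitary 𝔸, ∀ V ∈ TubeCfg ι 𝔸 a, F (fun b => W * V b * star W) = F V := fun W hW =>
  eqOn_tubeCfg_of_eqOn_unitary
    (hF.comp (differentiable_conj W (star W)).differentiableOn fun _ hV => conj_mem_tubeCfg hV hW) hF
    fun V hV => h26 W hW V hV

variable {D : LocDomainSys}

/-- **(J-b) UNCONDITIONAL — THE LINEAGE'S BINDER `hcls` FROM TWO LOCATED PRINTED PROPERTIES**: a localized family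
`E X` holomorphic on the tube (*"The third property is the analyticity with respect to U₁"*) and satisfying (26) for
the constant gauge transformations on the UNITARY-valued configurations (*"equalities hold 𝒫′₁(g₀, X, U₁ᵘ) =
𝒫′₁(g₀, X, U₁), (26) for all gauge transformations 𝓊"*, `U₁` `G`-valued) is a class function on the tube — the
binder `hcls` of `B10Eq31GlobalConj` / `B10Eq32SuN` verbatim (`B10Eq26MeasureInv.classFn_of_unitaryClassFn` with
its identity-principle hypothesis (H6) DISCHARGED by `tubeIdentity`).
[cite: Balaban1985UV3, (26) p.263 + p.263 («third property»); Balaban1987RG1, p.283; Balaban1988RG2Cluster, p.21] -/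
theorem classFn_tube_of_unitary {E : D.Dom → (ι → 𝔸) → ℂ} (hEan : ∀ X, DifferentiableOn ℂ (E X) (TubeCfg ι 𝔸 a))
    (h26 : ∀ X, ∀ W ∈ unitary 𝔸, ∀ V : ι → 𝔸, (∀ b, V b ∈ unitary 𝔸) →
      E X (fun b => W * V b * star W) = E X V) :
    ∀ X, ∀ W ∈ unitary 𝔸, ∀ V ∈ TubeCfg ι 𝔸 a, E X (fun b => W * V b * star W) = E X V :=
  classFn_of_unitaryClassFn (tubeIdentity a) hEan h26

/-- Hence the FLOW INVARIANCE on the tube along every one-parameter group `Ad exp(t·l)`, `l` skew-adjoint, `t` real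
(the shape consumed by the (31) ⇒ (32) derivations of the lineage, `B10Eq31GlobalConj.flowInvariant_of_classFn`).
[cite: Balaban1985UV3, (26) p.263, (31) p.264] -/
theorem flowInvariant_tube_of_unitary {E : D.Dom → (ι → 𝔸) → ℂ}
    (hEan : ∀ X, DifferentiableOn ℂ (E X) (TubeCfg ι 𝔸 a))
    (h26 : ∀ X, ∀ W ∈ unitary 𝔸, ∀ V : ι → 𝔸, (∀ b, V b ∈ unitary 𝔸) →
      E X (fun b => W * V b * star W) = E X V)
    (X : D.Dom) (l : skewAdjoint 𝔸) (t : ℝ) (V : ι → 𝔸) (hV : V ∈ TubeCfg ι 𝔸 a) :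
    E X (fun b => exp ((t : ℂ) • (l : 𝔸)) * V b * exp ((t : ℂ) • (-(l : 𝔸)))) = E X V :=
  flowInvariant_of_classFn (classFn_tube_of_unitary hEan h26) X l t V hV

/-- **MEASURE FORM — THE PRINTED MECHANISM WHERE PRINT STATES IT**: a measure-defined family
`measE ν F X V = ∫ F X V A dν_V(A)` whose fluctuation measure is COVARIANT and whose integrand is JOINTLY INVARIANT
under the simultaneous transformations `V ↦ (W·V_b·W⋆)_b`, `A ↦ e W A` ON THE UNITARY-VALUED CONFIGURATIONS (the
hypotheses (H3)/(H2) of `B10Eq26MeasureInv`, i.e. *"the invariance of the expressions in (13), if we make the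
simultaneous transformations U₁ → U₁ᵘ, A′ → R(𝓊)A′"* and *"The measure dA is invariant"*, read for `G`-valued `U₁`
as printed), and which is holomorphic on the tube, is a class function on the tube
(`B10Eq26MeasureInv.classFn_measE_of_unitaryCov` with (H6) discharged).
[cite: Balaban1985UV3, (26) p.263 (+ mechanism, «third property»); Balaban1987RG1, p.283] -/
theorem classFn_measE_tube_of_unitaryCov {Ω : Type*} [MeasurableSpace Ω] {ν : (ι → 𝔸) → Measure Ω}
    {F : D.Dom → (ι → 𝔸) → Ω → ℂ} {e : unitary 𝔸 → Ω ≃ᵐ Ω}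
    (hEan : ∀ X, DifferentiableOn ℂ (measE ν F X) (TubeCfg ι 𝔸 a))
    (hν : ∀ W : unitary 𝔸, ∀ V : ι → 𝔸, (∀ b, V b ∈ unitary 𝔸) →
      (ν V).map (e W) = ν (fun b => (W : 𝔸) * V b * star (W : 𝔸)))
    (hF : ∀ X, ∀ W : unitary 𝔸, ∀ V : ι → 𝔸, (∀ b, V b ∈ unitary 𝔸) →
      ∀ A, F X (fun b => (W : 𝔸) * V b * star (W : 𝔸)) (e W A) = F X V A) :
    ∀ X, ∀ W ∈ unitary 𝔸, ∀ V ∈ TubeCfg ι 𝔸 a, measE ν F X (fun b => W * V b * star W) = measE ν F X V :=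
  classFn_measE_of_unitaryCov (tubeIdentity a) hEan hν hF

end Consequences

/-! ## §4. THE JOINT THEOREMS OF THE LINEAGE WITH `hcls` REPLACED BY (26) ON UNITARY-VALUED CONFIGURATIONS
## (every other binder verbatim; holomorphy on the tube is already `hE` + `hsp`) -/

section Joint

variable {D : LocDomainSys} {ι : Type*} [Fintype ι] {𝔸 : Type*} [CStarAlgebra 𝔸]
  {sp' sp : D.Dom → Set (ι → 𝔸)} {E : D.Dom → (ι → 𝔸) → ℂ} {gen : D.Dom → (ι → 𝔸) → ι → 𝔸} {nX : D.Dom → ℕ}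

/-- **COMPLEX BACKGROUND — `B10Eq31GlobalConj.logHalfBound_expLine_cplx_of_classFn` WITH `hcls` DISCHARGED**: the
class-function binder on the complex tube is replaced by (26) for the constant gauge transformations on the
UNITARY-valued configurations (`h26`); holomorphy of `E X` on `sp X ⊇ TubeCfg ι 𝔸 a` (`hE`, `hsp`) supplies the
*"third property"*, and `tubeIdentity` the continuation.  Constant `8·((2p + q)/(min(1/8, a/2) − p))²·B`, rate
`r − 2`, all other binders unchanged.
[cite: Balaban1985UV3, (26) p.263 + p.263 («third property»), (29) p.263, (31)–(32) p.264, (61) p.271; Balaban1987RG1, (1.13) p.262, p.283] -/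
theorem logHalfBound_expLine_cplx_of_unitaryClassFn {B r a p q : ℝ} (hp : 0 ≤ p) (hq : 0 ≤ q) (hpq : 0 < p + q)
    (hpa : p < min (1 / 8) (a / 2)) (hB : 0 ≤ B)
    (hsplit : ∀ X φ, φ ∈ sp' X → ∀ b, ∃ S ∈ skewAdjoint 𝔸,
      ‖S‖ ≤ q * (1 + D.dj X) ∧ ‖gen X φ b - S‖ ≤ p)
    (hsp : ∀ X, TubeCfg ι 𝔸 a ⊆ sp X) (hE : ∀ X, DifferentiableOn ℂ (E X) (sp X))
    (h26 : ∀ X, ∀ W ∈ unitary 𝔸, ∀ V : ι → 𝔸, (∀ b, V b ∈ unitary 𝔸) →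
      E X (fun b => W * V b * star W) = E X V)
    (hcomm : ∀ X φ, φ ∈ sp' X → ∀ b, gen X φ b ∈ closure (commSpan 𝔸 : Set 𝔸))
    (hEb : B13.LogHalfBound D sp E nX B r) :
    B13.LogHalfBound D sp' (diffAlongV E (expLine gen (fun _ _ _ => 1))) nX
      (8 * ((2 * p + q) / (min (1 / 8) (a / 2) - p)) ^ 2 * B) (r - 2) :=
  logHalfBound_expLine_cplx_of_classFn hp hq hpq hpa hB hsplit hsp hE
    (classFn_tube_of_unitary (fun X => (hE X).mono (hsp X)) h26) hcomm hEb

/-- **(I.1.18) FOR THE DIFFERENCED (61)-PIECES ALONG COMPLEX BACKGROUNDS WITH `hcls` DISCHARGED** ([II]'s letters,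
printed R21, `α₁ < min(1/8, a/2)`): `B10Eq31GlobalConj.bound118_secondOrder_expLine_cplx_of_classFn` with the
class-function binder replaced by (26) on unitary-valued configurations.  Constant
`(64A(1 + c₀²)/(min(1/8, a/2) − α₁)²)·c₁`, rate `r − 3`.
[cite: Balaban1988RG2Cluster, pp.15, 20–21; Balaban1985UV3, (26) p.263 + p.263 («third property»), (29), (31)–(32) pp.263–264, (61) p.271; Balaban1987RG1, (1.12)–(1.13) p.262, p.283] -/
theorem bound118_secondOrder_expLine_cplx_of_unitaryClassFn (c : B13.Consts) (h21 : c.R21)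
    (hLM : 1 ≤ (c.L : ℝ) * c.M) (hα₀ : 0 ≤ c.α₀) (hα₁ : 0 < c.α₁) {A a c₀ r c₁ : ℝ} (hA : 0 ≤ A)
    (hc₀ : 0 ≤ c₀) (hα₁a : c.α₁ < min (1 / 8) (a / 2))
    (hsplit : ∀ X φ, φ ∈ sp' X → ∀ b, ∃ S ∈ skewAdjoint 𝔸,
      ‖S‖ ≤ c₀ * ((c.L : ℝ) * c.M) * c.α₀ * (1 + D.dj X) ∧ ‖gen X φ b - S‖ ≤ c.α₁)
    (hsp : ∀ X, TubeCfg ι 𝔸 a ⊆ sp X) (hE : ∀ X, DifferentiableOn ℂ (E X) (sp X))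
    (h26 : ∀ X, ∀ W ∈ unitary 𝔸, ∀ V : ι → 𝔸, (∀ b, V b ∈ unitary 𝔸) →
      E X (fun b => W * V b * star W) = E X V)
    (hcomm : ∀ X φ, φ ∈ sp' X → ∀ b, gen X φ b ∈ closure (commSpan 𝔸 : Set 𝔸))
    (hEb : B13.LogHalfBound D sp E nX (A * ((c.L : ℝ) * c.M) ^ 4) r) (hvol : B13.VolBoundK1 D nX c₁)
    (hc₁ : 0 ≤ c₁) :
    B13.Bound118 D sp' (diffAlongV E (expLine gen (fun _ _ _ => 1)))
      (64 * A * (1 + c₀ ^ 2) / (min (1 / 8) (a / 2) - c.α₁) ^ 2 * c₁) (r - 3) :=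
  bound118_secondOrder_expLine_cplx_of_classFn c h21 hLM hα₀ hα₁ hA hc₀ hα₁a hsplit hsp hE
    (classFn_tube_of_unitary (fun X => (hE X).mono (hsp X)) h26) hcomm hEb hvol hc₁

/-- **REAL BACKGROUND WITH `hcls` DISCHARGED**: `B10Eq31GlobalConj.logHalfBound_expLine_of_classFn` (skew-adjoint
generators of norm `≤ p + q(1 + d(X))`) with the class-function binder replaced by (26) on unitary-valued
configurations.  Constant `8((p + q)/a)²·B`, rate `r − 2`.
[cite: Balaban1985UV3, (26)–(28), (29) p.263 + p.263 («third property»), (31)–(32) p.264, (61) p.271] -/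
theorem logHalfBound_expLine_of_unitaryClassFn {B r a p q : ℝ} (ha : 0 < a) (hp : 0 ≤ p) (hq : 0 ≤ q)
    (hpq : 0 < p + q) (hB : 0 ≤ B) (hgen : ∀ X φ, φ ∈ sp' X → ∀ b, gen X φ b ∈ skewAdjoint 𝔸)
    (hbound : ∀ X φ, φ ∈ sp' X → ∀ b, ‖gen X φ b‖ ≤ p + q * (1 + D.dj X))
    (hsp : ∀ X, TubeCfg ι 𝔸 a ⊆ sp X) (hE : ∀ X, DifferentiableOn ℂ (E X) (sp X))
    (h26 : ∀ X, ∀ W ∈ unitary 𝔸, ∀ V : ι → 𝔸, (∀ b, V b ∈ unitary 𝔸) →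
      E X (fun b => W * V b * star W) = E X V)
    (hcomm : ∀ X φ, φ ∈ sp' X → ∀ b, gen X φ b ∈ closure (commSpan 𝔸 : Set 𝔸))
    (hEb : B13.LogHalfBound D sp E nX B r) :
    B13.LogHalfBound D sp' (diffAlongV E (expLine gen (fun _ _ _ => 1))) nX (8 * ((p + q) / a) ^ 2 * B)
      (r - 2) :=
  logHalfBound_expLine_of_classFn ha hp hq hpq hB hgen hbound hsp hE
    (classFn_tube_of_unitary (fun X => (hE X).mono (hsp X)) h26) hcomm hEb

/-- **MEASURE-DEFINED FAMILY — `B10Eq26MeasureInv.logHalfBound_expLine_cplx_of_cov` WITH ITS TWO MEASURE-LEVEL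
HYPOTHESES ASKED ON THE UNITARY-VALUED CONFIGURATIONS ONLY** (where print states the mechanism), holomorphy of
`measE ν F X` on `sp X ⊇` tube supplying the continuation.  Constant `8·((2p + q)/(min(1/8, a/2) − p))²·B`, rate
`r − 2`. [cite: Balaban1985UV3, (26) p.263 (+ mechanism, «third property»), (29) p.263, (31)–(32) p.264, (61) p.271; Balaban1987RG1, (1.13) p.262, p.283] -/
theorem logHalfBound_expLine_cplx_of_unitaryCov {B r a p q : ℝ} (hp : 0 ≤ p) (hq : 0 ≤ q) (hpq : 0 < p + q)
    (hpa : p < min (1 / 8) (a / 2)) (hB : 0 ≤ B) {Ω : Type*} [MeasurableSpace Ω] {ν : (ι → 𝔸) → Measure Ω}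
    {F : D.Dom → (ι → 𝔸) → Ω → ℂ} {e : unitary 𝔸 → Ω ≃ᵐ Ω}
    (hsplit : ∀ X φ, φ ∈ sp' X → ∀ b, ∃ S ∈ skewAdjoint 𝔸,
      ‖S‖ ≤ q * (1 + D.dj X) ∧ ‖gen X φ b - S‖ ≤ p)
    (hsp : ∀ X, TubeCfg ι 𝔸 a ⊆ sp X) (hE : ∀ X, DifferentiableOn ℂ (measE ν F X) (sp X))
    (hν : ∀ W : unitary 𝔸, ∀ V : ι → 𝔸, (∀ b, V b ∈ unitary 𝔸) →
      (ν V).map (e W) = ν (fun b => (W : 𝔸) * V b * star (W : 𝔸)))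
    (hF : ∀ X, ∀ W : unitary 𝔸, ∀ V : ι → 𝔸, (∀ b, V b ∈ unitary 𝔸) →
      ∀ A, F X (fun b => (W : 𝔸) * V b * star (W : 𝔸)) (e W A) = F X V A)
    (hcomm : ∀ X φ, φ ∈ sp' X → ∀ b, gen X φ b ∈ closure (commSpan 𝔸 : Set 𝔸))
    (hEb : B13.LogHalfBound D sp (measE ν F) nX B r) :
    B13.LogHalfBound D sp' (diffAlongV (measE ν F) (expLine gen (fun _ _ _ => 1))) nX
      (8 * ((2 * p + q) / (min (1 / 8) (a / 2) - p)) ^ 2 * B) (r - 2) :=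
  logHalfBound_expLine_cplx_of_classFn hp hq hpq hpa hB hsplit hsp hE
    (classFn_measE_tube_of_unitaryCov (fun X => (hE X).mono (hsp X)) hν hF) hcomm hEb

end Joint

/-! ## §5. THE `SU(N)` FORMS over `M_N(ℂ)` (`cstarAlgebraMatrix N` threaded by `letI`, no global instance):
## (26) for the constant `SU(N)`-valued gauge transformations on the `U(N)`-valued configurations -/

section SuN

open scoped Matrix.Norms.L2Operator

variable (N : ℕ) {D : LocDomainSys} {ι : Type*} [Fintype ι]
  {sp' sp : D.Dom → Set (ι → Matrix (Fin N) (Fin N) ℂ)} {E : D.Dom → (ι → Matrix (Fin N) (Fin N) ℂ) → ℂ}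
  {gen : D.Dom → (ι → Matrix (Fin N) (Fin N) ℂ) → ι → Matrix (Fin N) (Fin N) ℂ} {nX : D.Dom → ℕ}

/-- (H6) FOR `M_N(ℂ)` (adv2 XREAD C-adv2-75 SUGGESTION; here a special case of `tubeIdentity`): two functions
holomorphic on the bondwise tube of `M_N(ℂ)^ι` around `U(N)^ι` which agree on the `U(N)`-valued configurations agree
on the tube. [folklore] -/
theorem tubeIdentity_matrix (a : ℝ) :
    letI := cstarAlgebraMatrix N
    TubeIdentity ι (Matrix (Fin N) (Fin N) ℂ) a := by
  letI := cstarAlgebraMatrix N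
  exact tubeIdentity a

/-- `SU(N)`-(26) on the `U(N)`-valued configurations + holomorphy on the tube ⇒ the `U(N)`-class-function binder on
the tube: `U(N) = U(1)·SU(N)` with the centre invisible to conjugations (`B10Eq32SuN.classFn_of_suClassFn`, applied on
the unitary slice BEFORE the continuation), then `classFn_tube_of_unitary`.
[cite: Balaban1985UV3, (26) p.263 + p.263 («third property»), (31) p.264; Balaban1987RG1, p.283] -/
theorem classFn_tube_of_suUnitary {a : ℝ} :
    letI := cstarAlgebraMatrix N
    ∀ (_hEan : ∀ X, DifferentiableOn ℂ (E X) (TubeCfg ι (Matrix (Fin N) (Fin N) ℂ) a))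
      (_h26 : ∀ X, ∀ W ∈ Matrix.specialUnitaryGroup (Fin N) ℂ, ∀ V : ι → Matrix (Fin N) (Fin N) ℂ,
        (∀ b, V b ∈ Matrix.unitaryGroup (Fin N) ℂ) → E X (fun b => W * V b * star W) = E X V),
    ∀ X, ∀ W ∈ Matrix.unitaryGroup (Fin N) ℂ, ∀ V ∈ TubeCfg ι (Matrix (Fin N) (Fin N) ℂ) a,
      E X (fun b => W * V b * star W) = E X V := by
  letI := cstarAlgebraMatrix N
  intro hEan h26
  exact classFn_tube_of_unitary hEan fun X =>
    classFn_of_suClassFn (T := {V : ι → Matrix (Fin N) (Fin N) ℂ | ∀ b, V b ∈ Matrix.unitaryGroup (Fin N) ℂ})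
      (h26 X)

/-- **COMPLEX BACKGROUND, `SU(N)` FORM WITH `hcls` DISCHARGED**: (26) for the constant gauge transformations with
values in `SU(N)` on the `U(N)`-valued configurations, holomorphy of `E X` on `sp X ⊇` tube, traceless bond
generators (their skew part in `𝔰𝔲(N)`, complex part in `𝔰𝔩_N`: (27), [I] (1.13)) give the lineage's
`B13.LogHalfBound` for the differenced (61)-pieces.  Constant `8·((2p + q)/(min(1/8, a/2) − p))²·B`, rate `r − 2`.
[cite: Balaban1985UV3, (26)–(27), (29) p.263 + p.263 («third property»), (31)–(32) p.264, (61) p.271, p.272; Balaban1987RG1, (1.13) p.262, p.283] -/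
theorem logHalfBound_expLine_cplx_of_suUnitaryClassFn {B r a p q : ℝ} (hp : 0 ≤ p) (hq : 0 ≤ q)
    (hpq : 0 < p + q) (hpa : p < min (1 / 8) (a / 2)) (hB : 0 ≤ B) :
    letI := cstarAlgebraMatrix N
    ∀ (_hsplit : ∀ X φ, φ ∈ sp' X → ∀ b, ∃ S ∈ skewAdjoint (Matrix (Fin N) (Fin N) ℂ),
        ‖S‖ ≤ q * (1 + D.dj X) ∧ ‖gen X φ b - S‖ ≤ p)
      (_hsp : ∀ X, TubeCfg ι (Matrix (Fin N) (Fin N) ℂ) a ⊆ sp X) (_hE : ∀ X, DifferentiableOn ℂ (E X) (sp X))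
      (_h26 : ∀ X, ∀ W ∈ Matrix.specialUnitaryGroup (Fin N) ℂ, ∀ V : ι → Matrix (Fin N) (Fin N) ℂ,
        (∀ b, V b ∈ Matrix.unitaryGroup (Fin N) ℂ) → E X (fun b => W * V b * star W) = E X V)
      (_htr : ∀ X φ, φ ∈ sp' X → ∀ b, Matrix.trace (gen X φ b) = 0)
      (_hEb : B13.LogHalfBound D sp E nX B r),
    B13.LogHalfBound D sp' (diffAlongV E (expLine gen (fun _ _ _ => 1))) nX
      (8 * ((2 * p + q) / (min (1 / 8) (a / 2) - p)) ^ 2 * B) (r - 2) := by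
  letI := cstarAlgebraMatrix N
  intro hsplit hsp hE h26 htr hEb
  exact logHalfBound_expLine_cplx_of_classFn hp hq hpq hpa hB hsplit hsp hE
    (classFn_tube_of_suUnitary N (fun X => (hE X).mono (hsp X)) h26)
    (mem_closure_commSpan_of_trace_eq_zero N htr) hEb

/-- **(I.1.18) FOR THE DIFFERENCED (61)-PIECES, `SU(N)` FORM WITH `hcls` DISCHARGED** ([II]'s letters, printed R21,
`α₁ < min(1/8, a/2)`): constant `(64A(1 + c₀²)/(min(1/8, a/2) − α₁)²)·c₁`, rate `r − 3`.
[cite: Balaban1988RG2Cluster, pp.15, 20–21; Balaban1985UV3, (26)–(27), (29) p.263 + p.263 («third property»), (31)–(32) p.264, (61) p.271, p.272; Balaban1987RG1, (1.12)–(1.13) p.262, p.283] -/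
theorem bound118_secondOrder_expLine_cplx_of_suUnitaryClassFn (c : B13.Consts) (h21 : c.R21)
    (hLM : 1 ≤ (c.L : ℝ) * c.M) (hα₀ : 0 ≤ c.α₀) (hα₁ : 0 < c.α₁) {A a c₀ r c₁ : ℝ} (hA : 0 ≤ A)
    (hc₀ : 0 ≤ c₀) (hα₁a : c.α₁ < min (1 / 8) (a / 2)) :
    letI := cstarAlgebraMatrix N
    ∀ (_hsplit : ∀ X φ, φ ∈ sp' X → ∀ b, ∃ S ∈ skewAdjoint (Matrix (Fin N) (Fin N) ℂ),
        ‖S‖ ≤ c₀ * ((c.L : ℝ) * c.M) * c.α₀ * (1 + D.dj X) ∧ ‖gen X φ b - S‖ ≤ c.α₁)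
      (_hsp : ∀ X, TubeCfg ι (Matrix (Fin N) (Fin N) ℂ) a ⊆ sp X) (_hE : ∀ X, DifferentiableOn ℂ (E X) (sp X))
      (_h26 : ∀ X, ∀ W ∈ Matrix.specialUnitaryGroup (Fin N) ℂ, ∀ V : ι → Matrix (Fin N) (Fin N) ℂ,
        (∀ b, V b ∈ Matrix.unitaryGroup (Fin N) ℂ) → E X (fun b => W * V b * star W) = E X V)
      (_htr : ∀ X φ, φ ∈ sp' X → ∀ b, Matrix.trace (gen X φ b) = 0)
      (_hEb : B13.LogHalfBound D sp E nX (A * ((c.L : ℝ) * c.M) ^ 4) r) (_hvol : B13.VolBoundK1 D nX c₁)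
      (_hc₁ : 0 ≤ c₁),
    B13.Bound118 D sp' (diffAlongV E (expLine gen (fun _ _ _ => 1)))
      (64 * A * (1 + c₀ ^ 2) / (min (1 / 8) (a / 2) - c.α₁) ^ 2 * c₁) (r - 3) := by
  letI := cstarAlgebraMatrix N
  intro hsplit hsp hE h26 htr hEb hvol hc₁
  exact bound118_secondOrder_expLine_cplx_of_classFn c h21 hLM hα₀ hα₁ hA hc₀ hα₁a hsplit hsp hE
    (classFn_tube_of_suUnitary N (fun X => (hE X).mono (hsp X)) h26)
    (mem_closure_commSpan_of_trace_eq_zero N htr) hEb hvol hc₁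

/-- **REAL BACKGROUND, `SU(N)` FORM WITH `hcls` DISCHARGED**: generator in `𝔰𝔲(N)` bond by bond of norm
`≤ p + q(1 + d(X))`, (26) for the constant `SU(N)`-valued gauge transformations on the `U(N)`-valued configurations,
holomorphy on `sp X ⊇` tube; constant `8((p + q)/a)²·B`, rate `r − 2`.
[cite: Balaban1985UV3, (26)–(28), (29) p.263 + p.263 («third property»), (31)–(32) p.264, (61) p.271, p.272] -/
theorem logHalfBound_expLine_of_suUnitaryClassFn {B r a p q : ℝ} (ha : 0 < a) (hp : 0 ≤ p) (hq : 0 ≤ q)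
    (hpq : 0 < p + q) (hB : 0 ≤ B) :
    letI := cstarAlgebraMatrix N
    ∀ (_hskew : ∀ X φ, φ ∈ sp' X → ∀ b, gen X φ b ∈ skewAdjoint (Matrix (Fin N) (Fin N) ℂ))
      (_hbound : ∀ X φ, φ ∈ sp' X → ∀ b, ‖gen X φ b‖ ≤ p + q * (1 + D.dj X))
      (_hsp : ∀ X, TubeCfg ι (Matrix (Fin N) (Fin N) ℂ) a ⊆ sp X) (_hE : ∀ X, DifferentiableOn ℂ (E X) (sp X))
      (_h26 : ∀ X, ∀ W ∈ Matrix.specialUnitaryGroup (Fin N) ℂ, ∀ V : ι → Matrix (Fin N) (Fin N) ℂ,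
        (∀ b, V b ∈ Matrix.unitaryGroup (Fin N) ℂ) → E X (fun b => W * V b * star W) = E X V)
      (_htr : ∀ X φ, φ ∈ sp' X → ∀ b, Matrix.trace (gen X φ b) = 0)
      (_hEb : B13.LogHalfBound D sp E nX B r),
    B13.LogHalfBound D sp' (diffAlongV E (expLine gen (fun _ _ _ => 1))) nX (8 * ((p + q) / a) ^ 2 * B)
      (r - 2) := by
  letI := cstarAlgebraMatrix N
  intro hskew hbound hsp hE h26 htr hEb
  exact logHalfBound_expLine_of_classFn ha hp hq hpq hB hskew hbound hsp hE
    (classFn_tube_of_suUnitary N (fun X => (hE X).mono (hsp X)) h26)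
    (mem_closure_commSpan_of_trace_eq_zero N htr) hEb

end SuN

/-! ## §6. Non-vacuity and sharpness -/

section Toys

/-- (T1) THE TUBE IS STRICTLY BIGGER THAN THE UNITARY SLICE, already for `𝔸 = ℂ`, one bond, half-width `1`: the
configuration `e^{1/2}` (`B = 1/2`, `U = 1`) lies in the tube and is not unitary (`|e^{1/2}| = e^{1/2} ≠ 1`) — so
`tubeIdentity` is not the tautology «agree on the tube ⇒ agree on the tube». [folklore] -/
theorem example_tube_not_unitary :
    (fun _ : Unit => exp (((1 / 2 : ℝ) : ℂ)) * 1) ∈ TubeCfg Unit ℂ 1 ∧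
      ¬ ∀ b : Unit, (fun _ : Unit => exp (((1 / 2 : ℝ) : ℂ)) * 1) b ∈ unitary ℂ := by
  refine ⟨mem_tubeCfg.2 fun _ => exp_mul_mem_tube ?_ (one_mem _), fun h => ?_⟩
  · rw [Complex.norm_real, Real.norm_eq_abs, abs_of_pos (by norm_num : (0 : ℝ) < 1 / 2)]
    norm_num
  · have h1 : ‖exp (((1 / 2 : ℝ) : ℂ)) * (1 : ℂ)‖ = 1 := CStarRing.norm_of_mem_unitary (h ())
    rw [mul_one, ← congr_fun Complex.exp_eq_exp_ℂ, ← Complex.ofReal_exp, Complex.norm_real, Real.norm_eq_abs,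
      abs_of_pos (Real.exp_pos _), Real.exp_eq_one_iff] at h1
    norm_num at h1

/-- (T2) THE SLICE MUST BE THE WHOLE UNITARY GROUP OF THE BOND ALGEBRA: for `𝔸 = M₃(ℂ)` the polynomial (hence
holomorphic) function `V ↦ det (V b₀)` and the constant `1` agree on the `SU(3)`-valued configurations and differ
at the `U(3)`-valued configuration `−1` (`det(−1) = −1`).  So (26) on `SU(N)`-valued configurations alone does not
determine a function on the `M_N(ℂ)`-tube; §5 asks it on the `U(N)`-valued ones (header, HONEST SCOPE (iii)).
[folklore] -/
theorem example_su_slice_too_small :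
    (∀ V : Unit → Matrix (Fin 3) (Fin 3) ℂ, (∀ b, V b ∈ Matrix.specialUnitaryGroup (Fin 3) ℂ) →
        (V ()).det = 1) ∧
      ∃ V : Unit → Matrix (Fin 3) (Fin 3) ℂ, (∀ b, V b ∈ Matrix.unitaryGroup (Fin 3) ℂ) ∧ (V ()).det ≠ 1 := by
  refine ⟨fun V hV => (Matrix.mem_specialUnitaryGroup_iff.1 (hV ())).2, fun _ => -1, fun _ => ?_, ?_⟩
  · rw [Matrix.mem_unitaryGroup_iff]
    simp
  · rw [Matrix.det_neg, Matrix.det_one, Fintype.card_fin]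
    norm_num

end Toys

end Literature.MathematicalPhysics.QuantumFieldTheory.Balaban1983to89.B10Eq26TubeIdentity
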